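import Summits.CriticalPhenomena.PercolationContinuityZ3.Theorems.PercNearOneGluingNoHeavyLowerTailDecisionTreeFlip

/-!
# Exploration programs as flip-marked decision trees

Support file for crux `NoHeavyLowerTail` (item stmt-CriticalPhenomena-4575; FIBRE-P3⅔ line of prim-l12-p1, gen 29).  The dictionary of unit maps /
certificate programs of the memo `FROM-prim-l12-p1-g29-ANTITHETIC-TREES.md` consists of PROGRAMS: "explore the cluster of a root set through the
not-yet-queried edges whose bit equals `col`, querying every edge incident to the growing cluster, toggling each queried edge iff `fl`; then continue
with the next step on the remaining edges".  This file builds such a step as a `DTreeF` (by recursion on the number of available edges), with an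
arbitrary continuation indexed by the set of edges still available, and proves that the resulting tree is VALID and queries only available edges —
so that `DTreeF.sum_comp_flipT` / `flipT_injOn` / `certificate_sum_nonpos` apply to every such program.  No new mathematics; plumbing for the replay
of antithetic switching certificates.  (The semantic description of the output — which edges end up toggled — is not in this file.)
-/

namespace Summit.CriticalPhenomena.PercolationContinuityZ3.Theorems.DecisionTreeFlip

namespace DTreeF

open Finset

variable {ι : Type*} [LinearOrder ι] {V : Type*} [DecidableEq V]

/-- The available edges incident to the vertex set `S` (an edge is given by its two endpoints `ends e`). [folklore] -/
def frontier (ends : ι → V × V) (avail : Finset ι) (S : Finset V) : Finset ι :=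
  avail.filter fun e => (ends e).1 ∈ S ∨ (ends e).2 ∈ S

omit [LinearOrder ι] in
/-- The frontier is part of the available edges. [folklore] -/
theorem frontier_subset [DecidableEq ι] (ends : ι → V × V) (avail : Finset ι) (S : Finset V) : frontier ends avail S ⊆ avail :=
  filter_subset _ _

/-- One exploration step as a flip-marked tree: while some available edge meets the current vertex set `S`, query the least such edge `e`
(toggling it iff `fl`); if its bit equals `col` the far endpoints join `S`; in both cases `e` leaves the available set; when no available edge meets
`S`, continue with `κ` on the remaining available edges.  Recursion on `avail.card`. [folklore] -/
def explore (ends : ι → V × V) (col fl : Bool) (κ : Finset ι → DTreeF ι) : (avail : Finset ι) → (S : Finset V) → DTreeF ι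
  | avail, S =>
    if h : (frontier ends avail S).Nonempty then
      let e := (frontier ends avail S).min' h
      have : (avail.erase e).card < avail.card :=
        card_erase_lt_of_mem (frontier_subset ends avail S (min'_mem _ h))
      let grow : DTreeF ι := explore ends col fl κ (avail.erase e) (insert (ends e).1 (insert (ends e).2 S))
      let stay : DTreeF ι := explore ends col fl κ (avail.erase e) S
      if col then node e fl grow stay else node e fl stay grow
    else κ avail
  termination_by avail => avail.card

/-- Unfolding `explore` when some available edge meets `S`. [folklore] -/
theorem explore_eq_of_nonempty (ends : ι → V × V) (col fl : Bool) (κ : Finset ι → DTreeF ι) (avail : Finset ι) (S : Finset V)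
    (h : (frontier ends avail S).Nonempty) :
    explore ends col fl κ avail S =
      (if col then
        node ((frontier ends avail S).min' h) fl
          (explore ends col fl κ (avail.erase ((frontier ends avail S).min' h))
            (insert (ends ((frontier ends avail S).min' h)).1 (insert (ends ((frontier ends avail S).min' h)).2 S)))
          (explore ends col fl κ (avail.erase ((frontier ends avail S).min' h)) S)
      else
        node ((frontier ends avail S).min' h) fl
          (explore ends col fl κ (avail.erase ((frontier ends avail S).min' h)) S)
          (explore ends col fl κ (avail.erase ((frontier ends avail S).min' h))
            (insert (ends ((frontier ends avail S).min' h)).1 (insert (ends ((frontier ends avail S).min' h)).2 S)))) := by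
  rw [explore, dif_pos h]

/-- Unfolding `explore` when no available edge meets `S`: the continuation takes over. [folklore] -/
theorem explore_eq_of_not_nonempty (ends : ι → V × V) (col fl : Bool) (κ : Finset ι → DTreeF ι) (avail : Finset ι) (S : Finset V)
    (h : ¬ (frontier ends avail S).Nonempty) : explore ends col fl κ avail S = κ avail := by
  rw [explore, dif_neg h]

omit [LinearOrder ι] in
/-- The support of a node with children whose supports lie in `avail.erase e`, `e ∈ avail`, lies in `avail`. [folklore] -/
theorem supportF_node_subset [DecidableEq ι] {e : ι} {fl : Bool} {c1 c0 : DTreeF ι} {avail : Finset ι} (he : e ∈ avail)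
    (h1 : supportF c1 ⊆ avail.erase e) (h0 : supportF c0 ⊆ avail.erase e) : supportF (node e fl c1 c0) ⊆ avail := by
  intro i hi
  simp only [supportF, mem_insert, mem_union] at hi
  rcases hi with rfl | hi | hi
  · exact he
  · exact (erase_subset _ _) (h1 hi)
  · exact (erase_subset _ _) (h0 hi)

omit [LinearOrder ι] in
/-- A node whose children are valid with supports in `avail.erase e` is valid. [folklore] -/
theorem validF_node_of [DecidableEq ι] {e : ι} {fl : Bool} {c1 c0 : DTreeF ι} {avail : Finset ι}
    (h1 : supportF c1 ⊆ avail.erase e) (h0 : supportF c0 ⊆ avail.erase e) (v1 : validF c1 = true) (v0 : validF c0 = true) :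
    validF (node e fl c1 c0) = true := by
  have n1 : e ∉ supportF c1 := fun h => (notMem_erase e avail) (h1 h)
  have n0 : e ∉ supportF c0 := fun h => (notMem_erase e avail) (h0 h)
  simp [validF, n1, n0, v1, v0]

/-- The exploration tree queries only available edges, provided the continuation does. [folklore] -/
theorem supportF_explore_subset (ends : ι → V × V) (col fl : Bool) (κ : Finset ι → DTreeF ι)
    (hκ : ∀ A : Finset ι, supportF (κ A) ⊆ A) :
    ∀ (avail : Finset ι) (S : Finset V), supportF (explore ends col fl κ avail S) ⊆ avail := by
  intro avail
  induction avail using Finset.strongInduction with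
  | H avail ih =>
    intro S
    by_cases h : (frontier ends avail S).Nonempty
    · rw [explore_eq_of_nonempty ends col fl κ avail S h]
      have hmem : (frontier ends avail S).min' h ∈ avail := frontier_subset ends avail S (min'_mem _ h)
      have hss : avail.erase ((frontier ends avail S).min' h) ⊂ avail := erase_ssubset hmem
      cases col
      · simp only [Bool.false_eq_true, if_false]
        exact supportF_node_subset hmem (ih _ hss _) (ih _ hss _)
      · simp only [if_true]
        exact supportF_node_subset hmem (ih _ hss _) (ih _ hss _)
    · rw [explore_eq_of_not_nonempty ends col fl κ avail S h]
      exact hκ avail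

/-- The exploration tree is valid (never re-queries an edge), provided the continuation is valid and queries only the edges handed to it.
[folklore] -/
theorem validF_explore (ends : ι → V × V) (col fl : Bool) (κ : Finset ι → DTreeF ι)
    (hκ : ∀ A : Finset ι, supportF (κ A) ⊆ A) (hκv : ∀ A : Finset ι, validF (κ A) = true) :
    ∀ (avail : Finset ι) (S : Finset V), validF (explore ends col fl κ avail S) = true := by
  intro avail
  induction avail using Finset.strongInduction with
  | H avail ih =>
    intro S
    by_cases h : (frontier ends avail S).Nonempty
    · rw [explore_eq_of_nonempty ends col fl κ avail S h]
      have hmem : (frontier ends avail S).min' h ∈ avail := frontier_subset ends avail S (min'_mem _ h)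
      have hss : avail.erase ((frontier ends avail S).min' h) ⊂ avail := erase_ssubset hmem
      have hsup := fun S' => supportF_explore_subset ends col fl κ hκ (avail.erase ((frontier ends avail S).min' h)) S'
      cases col
      · simp only [Bool.false_eq_true, if_false]
        exact validF_node_of (hsup _) (hsup _) (ih _ hss _) (ih _ hss _)
      · simp only [if_true]
        exact validF_node_of (hsup _) (hsup _) (ih _ hss _) (ih _ hss _)
    · rw [explore_eq_of_not_nonempty ends col fl κ avail S h]
      exact hκv avail

/-- A PROGRAM: a list of steps `(roots, col, fl)`; its tree explores, step after step, through the edges not queried by earlier steps, and ends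
in a leaf. [folklore] -/
def programTree (ends : ι → V × V) : List (Finset V × Bool × Bool) → Finset ι → DTreeF ι
  | [], _ => leaf
  | (S, col, fl) :: rest, avail => explore ends col fl (fun A => programTree ends rest A) avail S

/-- A program tree queries only the edges it is given. [folklore] -/
theorem supportF_programTree_subset (ends : ι → V × V) :
    ∀ (prog : List (Finset V × Bool × Bool)) (avail : Finset ι), supportF (programTree ends prog avail) ⊆ avail
  | [], avail => by simp [programTree, supportF]
  | (S, col, fl) :: rest, avail => by
      rw [programTree]
      exact supportF_explore_subset ends col fl _ (fun A => supportF_programTree_subset ends rest A) avail S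

/-- **Every exploration program is a valid flip-marked tree**; hence (`sum_comp_flipT`, `flipT_injOn`) its output map `flipT` is a bijection of
`D.powerset` for every `D ⊇ avail`, and finitely many programs obey the certificate principle `certificate_sum_nonpos`. [folklore] -/
theorem validF_programTree (ends : ι → V × V) :
    ∀ (prog : List (Finset V × Bool × Bool)) (avail : Finset ι), validF (programTree ends prog avail) = true
  | [], avail => by simp [programTree, validF]
  | (S, col, fl) :: rest, avail => by
      rw [programTree]
      exact validF_explore ends col fl _ (fun A => supportF_programTree_subset ends rest A)
        (fun A => validF_programTree ends rest A) avail S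

/-- The output map of an exploration program is injective on `D.powerset` whenever the program is run on available edges `avail ⊆ D`.
[folklore] -/
theorem flipT_programTree_injOn (ends : ι → V × V) (prog : List (Finset V × Bool × Bool)) {avail D : Finset ι}
    (hD : avail ⊆ D) : Set.InjOn (flipT (programTree ends prog avail)) (↑D.powerset : Set (Finset ι)) :=
  flipT_injOn (validF_programTree ends prog avail) ((supportF_programTree_subset ends prog avail).trans hD)

end DTreeF

end Summit.CriticalPhenomena.PercolationContinuityZ3.Theorems.DecisionTreeFlip
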